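import Summits.CriticalPhenomena.PercolationContinuityZ3.Theorems.PercNearOneGluingNoHeavyLowerTailSahiE3Hit3Pattern
import Summits.CriticalPhenomena.PercolationContinuityZ3.Theorems.PercNearOneGluingNoHeavyLowerTailSahiE3Hit3PatternFacts
import Summits.CriticalPhenomena.PercolationContinuityZ3.Theorems.PercNearOneGluingNoHeavyLowerTailSahiE3Hit3CoreCert
import Summits.CriticalPhenomena.PercolationContinuityZ3.Theorems.PercNearOneGluingNoHeavyLowerTailSahiE3PatternCertificate
import Summits.CriticalPhenomena.PercolationContinuityZ3.Theorems.PercNearOneGluingNoHeavyLowerTailSahiE3MajSlot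
import Literature.Combinatorics.Sahi2008.Percolation
import Mathlib.Data.Fin.VecNotation
import Mathlib.Tactic.FinCases
import HarnessLib
import HarnessLib.Audit

/-!
# `NoHeavyLowerTail` (crux stmt-CriticalPhenomena-4575), Sahi programme P4 (Holley / monotone coupling):
# FKG slot-locality for "one of three join-primes" (the hitting pattern `1+2+3`) — the `1+2+3` slot theorem

Support file (cell `prim-l12`, seat P4, generation 10; `--supports stmt-CriticalPhenomena-4575`).  No named facts, no sorries; standard
axioms; def-free.

THEOREM (`latticeE3_nonneg_of_hitThree`).  For every finite distributive lattice `L`, every nonnegative log-supermodular weight `μ` (an FKG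
measure, zeros allowed, not normalised), up-sets `A, B ⊆ L` and join-prime `j₁, j₂, j₃`:
`0 ≤ latticeE3 μ (principalUp j₁ ∪ principalUp j₂ ∪ principalUp j₃) A B`, i.e. Sahi's third-order inequality `C₃` for the triple (`{x | j₁ ≤ x ∨ j₂ ≤ x ∨ j₃ ≤ x}`, `A`, `B`).  Boolean
form `latticeE3_nonneg_hitThree_cube` (slot `{ω | a ∈ ω ∨ b ∈ ω ∨ c ∈ ω}`, `A, B` arbitrary increasing events, every log-supermodular weight on `2^ι`) and
product-measure form `kahn_of_hitThree`.  Reach: the 134 tri-saturated orbits whose slot has the reduced pattern `1+2+3` (the k = 3 case of the hitting-slot programme of generations 6–7: the ρ-lemma / (RG) at k = 3 is thereby settled for every FKG measure), completing ALL slot patterns on `2³`: with `…SahiE3TwoPrimeSlot`, `…SahiE3FilterRestriction`, `…SahiE3MajSlot`, `…SahiE3OrPairSlot` and Sahi's principal-slot theorem, Sahi's `C₃` now holds under every FKG measure on every finite distributive lattice whenever one slot is generated by at most three join-primes (762 of the 1,067 residual `k = 5` orbits); HOME prim-l12-p4/STATUS.md.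

PROOF.  `…SahiE3PatternCertificate.latticeE3_nonneg_of_patternCertificate` (generation 8) reduces the claim to a FLOW CERTIFICATE for the pattern
measure `ν` of `x ↦ (jᵢ ≤ x)_i` on `2³` with slot set `OP = {100, 010, 001, 110, 101, 011, 111}`; `…SahiE3Hit3Pattern.certificate_of_ineqs` reduces the certificate to
185 real inequalities on the eight fibre masses; `…SahiE3Hit3Pattern.facts_of_pattern` derives the consequences of log-supermodularity of `ν`;
`…SahiE3Hit3Cert.exists_cert` produces the retained masses REGIME-FREE (Fourier–Motzkin replay over machine-certified real algebra with exact
LP-redundancy pruning, `…SahiE3Hit3Alg*`, `…SahiE3Hit3Core*`; memo HOME prim-l12-p4/FROM-prim-l12-p4-gen10-ORPAIR-SLOT-FM.md).  This file only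
identifies the preimage of `OP` with the slot.
-/

namespace Summit.CriticalPhenomena.PercolationContinuityZ3.Theorems.SahiE3Hit3Slot

open Finset Literature.Probability.LatticeModels
open scoped BigOperators

variable {α : Type*} [DistribLattice α] [Fintype α] [DecidableEq α] [DecidableLE α]

/-- **FKG slot-locality for "one of three join-primes" (the hitting pattern `1+2+3`).**  For every nonnegative log-supermodular weight `μ` on a finite distributive
lattice, up-sets `A, B` and join-prime `j₁, j₂, j₃`: `0 ≤ latticeE3 μ (principalUp j₁ ∪ principalUp j₂ ∪ principalUp j₃) A B`. [this work] -/
theorem latticeE3_nonneg_of_hitThree {μ : α → ℝ} (hμ₀ : 0 ≤ μ) (hμ : ∀ a b, μ a * μ b ≤ μ (a ⊓ b) * μ (a ⊔ b))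
    {j₁ j₂ j₃ : α} (hj₁ : SupPrime j₁) (hj₂ : SupPrime j₂) (hj₃ : SupPrime j₃) {A B : Finset α}
    (hA : IsUpperSet (A : Set α)) (hB : IsUpperSet (B : Set α)) :
    0 ≤ latticeE3 μ (principalUp j₁ ∪ principalUp j₂ ∪ principalUp j₃) A B := by
  -- the pattern map of the three join-primes
  set j : Fin 3 → α := ![j₁, j₂, j₃] with hjdef
  have hj : ∀ i, SupPrime (j i) := by
    intro i; fin_cases i
    · exact hj₁
    · exact hj₂
    · exact hj₃
  set F : (Fin 3 → Bool) → Finset α := fun t => univ.filter fun x => ∀ i, (j i ≤ x ↔ t i = true) with hFdef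
  have hF : ∀ (t : Fin 3 → Bool) (x : α), x ∈ F t ↔ ∀ i, (j i ≤ x ↔ t i = true) := by
    intro t x; simp [hFdef]
  set ν : (Fin 3 → Bool) → ℝ := fun t => mass μ (F t) with hνdef
  have hν0 : ∀ t, 0 ≤ ν t := fun t => mass_nonneg hμ₀ _
  have hU : IsUpperSet ((univ : Finset α) : Set α) := fun _ _ _ _ => Finset.mem_univ _
  have hν : ∀ s t, ν s * ν t ≤ ν (s ⊓ t) * ν (s ⊔ t) := by
    intro s t
    have h := SahiE3HitSlotCertificate.fib_ad hμ₀ hμ hj hF hU hU s t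
    simpa only [Finset.univ_inter] using h
  -- the facts, the certificate data, the certificate
  have hf := SahiE3Hit3Pattern.facts_of_pattern ν hν0 hν _ _ _ _ _ _ _ _ _ rfl rfl rfl rfl rfl rfl rfl rfl rfl
  obtain ⟨r0, r1, r2, r01, r02, r12, rT, H⟩ := SahiE3Hit3Cert.exists_cert _ _ _ _ _ _ _ _ _ _ _ _ _ _ _ _ _ _ _ _ _ _ _ _ _ _ _ rfl rfl rfl rfl rfl rfl rfl rfl rfl rfl rfl rfl rfl rfl rfl rfl rfl rfl hf
  obtain ⟨R, Fl, h1, h2, h3, h4, h5, h6⟩ :=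
    SahiE3Hit3Pattern.certificate_of_ineqs _ rfl ν hν0 hν _ _ _ _ _ _ _ _ _ rfl rfl rfl rfl rfl rfl rfl rfl rfl r0 r1 r2 r01 r02 r12 rT _ _ _ _ _ _ _ _ _ _ _ _ _ _ _ _ _ _ rfl rfl rfl rfl rfl rfl rfl rfl rfl rfl rfl rfl rfl rfl rfl rfl rfl rfl H
  have key := SahiE3PatternCertificate.latticeE3_nonneg_of_patternCertificate hμ₀ hμ hj hF hA hB _ ν (fun t => rfl) R Fl
    h1 h2 h3 h4 h5 h6
  -- identify the slot
  have hslot : (univ.filter fun x : α => (fun i => decide (j i ≤ x)) ∈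
      ({![true, false, false], ![false, true, false], ![false, false, true], ![true, true, false], ![true, false, true], ![false, true, true], ![true, true, true]} : Finset (Fin 3 → Bool))) =
      principalUp j₁ ∪ principalUp j₂ ∪ principalUp j₃ := by
    ext x
    simp only [Finset.mem_filter, Finset.mem_univ, true_and, Finset.mem_union, mem_principalUp,
      Finset.mem_insert, Finset.mem_singleton, funext_iff, Fin.forall_fin_succ, Fin.forall_fin_zero, hjdef,
      Matrix.cons_val_zero, Matrix.cons_val_succ, Matrix.cons_val_fin_one, decide_eq_true_eq, decide_eq_false_iff_not,
      and_true]
    by_cases ha : j₁ ≤ x <;> by_cases hb : j₂ ≤ x <;> by_cases hc : j₃ ≤ x <;> simp [ha, hb, hc]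
  rw [hslot] at key
  exact key

/-- The same with join-IRREDUCIBLE `j₁, j₂, j₃` (equivalent to join-prime on a distributive lattice). [this work] -/
theorem latticeE3_nonneg_of_hitThree_supIrred {μ : α → ℝ} (hμ₀ : 0 ≤ μ) (hμ : ∀ a b, μ a * μ b ≤ μ (a ⊓ b) * μ (a ⊔ b))
    {j₁ j₂ j₃ : α} (hj₁ : SupIrred j₁) (hj₂ : SupIrred j₂) (hj₃ : SupIrred j₃) {A B : Finset α}
    (hA : IsUpperSet (A : Set α)) (hB : IsUpperSet (B : Set α)) :
    0 ≤ latticeE3 μ (principalUp j₁ ∪ principalUp j₂ ∪ principalUp j₃) A B :=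
  latticeE3_nonneg_of_hitThree hμ₀ hμ hj₁.supPrime hj₂.supPrime hj₃.supPrime hA hB

/-- The slot in the second position. [this work] -/
theorem latticeE3_nonneg_of_hitThree₂ {μ : α → ℝ} (hμ₀ : 0 ≤ μ) (hμ : ∀ a b, μ a * μ b ≤ μ (a ⊓ b) * μ (a ⊔ b))
    {j₁ j₂ j₃ : α} (hj₁ : SupPrime j₁) (hj₂ : SupPrime j₂) (hj₃ : SupPrime j₃) {A B : Finset α}
    (hA : IsUpperSet (A : Set α)) (hB : IsUpperSet (B : Set α)) :
    0 ≤ latticeE3 μ A (principalUp j₁ ∪ principalUp j₂ ∪ principalUp j₃) B := by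
  rw [SahiC3Cube.latticeE3_comm₁₂]; exact latticeE3_nonneg_of_hitThree hμ₀ hμ hj₁ hj₂ hj₃ hA hB

/-- The slot in the third position. [this work] -/
theorem latticeE3_nonneg_of_hitThree₃ {μ : α → ℝ} (hμ₀ : 0 ≤ μ) (hμ : ∀ a b, μ a * μ b ≤ μ (a ⊓ b) * μ (a ⊔ b))
    {j₁ j₂ j₃ : α} (hj₁ : SupPrime j₁) (hj₂ : SupPrime j₂) (hj₃ : SupPrime j₃) {A B : Finset α}
    (hA : IsUpperSet (A : Set α)) (hB : IsUpperSet (B : Set α)) :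
    0 ≤ latticeE3 μ A B (principalUp j₁ ∪ principalUp j₂ ∪ principalUp j₃) := by
  rw [SahiC3Cube.latticeE3_comm₁₃]; exact latticeE3_nonneg_of_hitThree hμ₀ hμ hj₁ hj₂ hj₃ hB hA

open Literature.Combinatorics.Sahi2008 in
/-- **Sahi's `E₃ ≥ 0` for every FKG probability weight** on a finite distributive lattice (the `n = 3` functional of the tree's
`SahiConjecture`, Literature `sahiE μ 3`) for the slot `{x | j₁ ≤ x ∨ j₂ ≤ x ∨ j₃ ≤ x}`, `A, B` increasing events, `j₁, j₂, j₃` join-prime. [this work] -/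
theorem sahiE_three_nonneg_of_hitThree {μ : α → ℝ} (hμ : IsFKGMeasure μ) {j₁ j₂ j₃ : α} (hj₁ : SupPrime j₁) (hj₂ : SupPrime j₂)
    (hj₃ : SupPrime j₃) {A B : Finset α} (hA : IsUpperSet (A : Set α)) (hB : IsUpperSet (B : Set α)) :
    0 ≤ sahiE μ 3 ![setInd (principalUp j₁ ∪ principalUp j₂ ∪ principalUp j₃), setInd A, setInd B] := by
  rw [sahiE_three_indicator_eq_latticeE3 hμ.sum_eq_one]
  exact latticeE3_nonneg_of_hitThree hμ.nonneg hμ.mul_le_mul hj₁ hj₂ hj₃ hA hB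

/-! ### Boolean lattices -/

section Boolean

variable {ι : Type*} [Fintype ι] [DecidableEq ι]

/-- The slot as a filter on `Finset ι`. [this work] -/
theorem principalUp_union_eq_filter_hitThree (a b c : ι) :
    principalUp ({a} : Finset ι) ∪ principalUp ({b} : Finset ι) ∪ principalUp ({c} : Finset ι) =
      univ.filter fun ω : Finset ι => a ∈ ω ∨ b ∈ ω ∨ c ∈ ω := by
  ext ω
  simp [mem_principalUp, Finset.singleton_subset_iff]

/-- **Sahi's `C₃` on `2^ι` for every FKG weight when one slot is `{ω | a ∈ ω ∨ b ∈ ω ∨ c ∈ ω}`**, the other two slots arbitrary up-sets.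
[this work] -/
theorem latticeE3_nonneg_hitThree_cube {μ : Finset ι → ℝ} (hμ₀ : 0 ≤ μ) (hμ : ∀ a b, μ a * μ b ≤ μ (a ⊓ b) * μ (a ⊔ b))
    (a b c : ι) {A B : Finset (Finset ι)} (hA : IsUpperSet (A : Set (Finset ι))) (hB : IsUpperSet (B : Set (Finset ι))) :
    0 ≤ latticeE3 μ (univ.filter fun ω : Finset ι => a ∈ ω ∨ b ∈ ω ∨ c ∈ ω) A B := by
  rw [← principalUp_union_eq_filter_hitThree]
  exact latticeE3_nonneg_of_hitThree hμ₀ hμ (SahiE3CovHit.supPrime_singleton' a) (SahiE3CovHit.supPrime_singleton' b)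
    (SahiE3CovHit.supPrime_singleton' c) hA hB

end Boolean

/-! ### Kahn's Conjecture 5 (product measures on `Set ι`) for this slot -/

section Kahn

open MeasureTheory Literature.Combinatorics.Sahi2008 Literature.Probability.Percolation

variable {ι : Type*} [Fintype ι]

/-- **Kahn's Conjecture 5 holds whenever one of the three increasing events is `{ω | a ∈ ω ∨ b ∈ ω ∨ c ∈ ω}`**, for every finite index type,
every `p : ι → [0,1]` and ALL increasing `A, B ⊆ Set ι` (the slot theorem for the log-modular product weight `bernoulliWeight p` on
`Set ι`, via `Literature…sahiE_three_ind`). [this work] -/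
theorem kahn_of_hitThree (p : ι → unitInterval) (a b c : ι) {A B : Set (Set ι)} (hA : IsUpperSet A) (hB : IsUpperSet B) :
    0 ≤ Literature.Probability.LatticeModels.sahiE3 (prodBernoulli p)
      {ω : Set ι | a ∈ ω ∨ b ∈ ω ∨ c ∈ ω} A B := by
  classical
  rw [← sahiE_three_ind]
  have hμ := isFKGMeasure_bernoulliWeight p
  have hA' : IsUpperSet ((A.toFinset : Finset (Set ι)) : Set (Set ι)) := by simpa using hA
  have hB' : IsUpperSet ((B.toFinset : Finset (Set ι)) : Set (Set ι)) := by simpa using hB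
  have key := sahiE_three_nonneg_of_hitThree hμ (SahiE3MajSlot.supPrime_set_singleton a) (SahiE3MajSlot.supPrime_set_singleton b)
    (SahiE3MajSlot.supPrime_set_singleton c) hA' hB'
  refine le_of_le_of_eq key ?_
  congr 1
  funext i
  fin_cases i
  · funext ω
    by_cases h1 : a ∈ ω <;> by_cases h2 : b ∈ ω <;> by_cases h3 : c ∈ ω <;>
      simp [setInd_apply, DecisionTree.ind, mem_principalUp, h1, h2, h3]
  · funext ω
    simp [setInd_apply, DecisionTree.ind]
  · funext ω
    simp [setInd_apply, DecisionTree.ind]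

end Kahn

end Summit.CriticalPhenomena.PercolationContinuityZ3.Theorems.SahiE3Hit3Slot
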